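import Mathlib.Data.Fintype.BigOperators
import Mathlib.Data.Fin.Tuple.Basic
import Literature.Probability.LatticeModels.SharpnessSubcritical
import Literature.Probability.Percolation.SharpnessDCTProofs
import Literature.Barriers.CriticalPhenomena.GaussianDominationRouteXSpace
import HarnessLib

/-!
# RSW3 lane (P2, gen 21): KESTEN'S THEOREM (8) IN ALL MOMENTS, II — nearest-neighbour radii and the INSERTION INEQUALITY
# (no probability: lattice combinatorics of a finite family of sites)

builds on p205010 (kernel theorem, internal audit signed; external expert review pending) — NOT used in this file.

Cell `prim-rsw3`, prover seat `prim-rsw3-p2` (gen 21), memo `run/shared/lean/prim/rsw3/P2-RSWLITE.md` §28.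
Support file (`--supports stmt-CriticalPhenomena-4575`); no definitions, no named facts, no sorries.

The combinatorial core of the moment bounds (Kesten 1986, Thm. (8); the induction on the number of points is the simplification
Kesten credits to B. G. Nguyen, footnote 5 there).  For a finite family `S` of sites and `x ∈ S` write (INLINE — the expression
is written out in every statement; this file introduces no definition and no notation)
  `δ⟦S, x⟧ = min_{y ∈ S, y ≠ x} ‖x − y‖_∞`  (`:= ENat.toNat ((S.erase x).inf fun y => ↑‖x − y‖_∞)`, `= 0` if `S ⊆ {x}`),
the NEAREST-NEIGHBOUR DISTANCE of `x` in `S`; the ball bound of part I is applied with the radii `⌊(δ⟦S,x⟧ − 1)/2⌋`, whose balls are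
pairwise disjoint (`nnd_radii_add_lt`).  For a weight `f : ℕ → ℝ` (later `f(m) = π_p(⌊(m−1)/2⌋)`) put `W(S) = ∏_{x ∈ S} f(δ⟦S, x⟧)`.

* `exists_nnd_eq`, `nnd_le`, `one_le_nnd`, `nnd_radii_add_lt`, `supNorm_add_nnd_radius_le` — bookkeeping;
* `nnd_insert_self`, `nnd_insert_of_mem`, `nnd_le_two_mul_nnd_insert` — inserting a point `a ∉ S` with nearest point `b ∈ S`:
  `δ⟦S ∪ a, a⟧ = ‖a − b‖`, `δ⟦S ∪ a, x⟧ = min(‖x − a‖, δ⟦S, x⟧)` and **`δ⟦S, x⟧ ≤ 2·δ⟦S ∪ a, x⟧`** for `x ∈ S` — inserting a point at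
  most HALVES the nearest-neighbour distance of every old point other than... (indeed of every old point: `‖x − b‖ ≤ ‖x − a‖ + ‖a − b‖ ≤ 2‖x − a‖`);
* **`prod_insert_nnd_le` (THE INSERTION INEQUALITY)**: if `f > 0` satisfies the doubling bound `f(u) ≤ D·f(v)` for `u ≤ v ≤ 2u`, then for
  `|S| ≥ 2`, `a ∉ S` and `b ∈ S` a nearest point to `a`,
  `W(S ∪ {a}) ≤ D^{|S|−1} · f(‖a − b‖) · (f(min(‖a − b‖, δ⟦S,b⟧)) / f(δ⟦S,b⟧)) · W(S)`;
* **`sum_prod_insert_nnd_le`** — summed over the inserted point `a ∈ T`: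
  `Σ_{a ∈ T} W(S ∪ {a}) ≤ W(S) · (|S| + D^{|S|−1} · Σ_{b ∈ S} Σ_{a ∈ T} f(‖a−b‖)·f(min(‖a−b‖, δ⟦S,b⟧))/f(δ⟦S,b⟧))`;
* `nnd_pair_left/right`, `nnd_singleton`, `nnd_le_two_mul_of_subset_box` — pairs, singletons, families in a box;
* `image_univ_cons`, `sum_piFinset_succ_const`, `sum_piFinset_zero_const`, `card_insert_image_le`, `insert_image_subset_box`,
  `iInter_openConn_eq_biInter` — bookkeeping for tuples `q : Fin t → Λ(n)` and the families `S(q) = {0} ∪ range q`.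

References: H. Kesten, Probab. Theory Relat. Fields 73 (1986) 369–394, Thm. (8), (44)–(53) and footnote 5 [Kesten1986];
B. G. Nguyen, *Typical cluster size for two-dimensional percolation processes*, J. Stat. Phys. 50 (1988) (gap exponents by induction).
[folklore]
-/

noncomputable section

namespace Summit.CriticalPhenomena.PercolationContinuityZ3.Theorems

namespace Rsw3

open Literature.Probability.LatticeModels Literature.Probability.Percolation Finset
open Literature.Barriers.CriticalPhenomena (sub_mem_box_two_mul)

variable {d : ℕ}


/-! ## Bookkeeping for the nearest-neighbour distance -/

/-- The nearest-neighbour distance is attained. [folklore] -/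
theorem exists_nnd_eq {S : Finset (Site d)} {x : Site d} (h : (S.erase x).Nonempty) :
    ∃ y ∈ S, y ≠ x ∧ ((Finset.erase (S) (x)).inf (fun w => ((Site.supNorm ((x) - w) : ℕ) : ℕ∞))).toNat = Site.supNorm (x - y) := by
  obtain ⟨y, hy, hyeq⟩ := Finset.exists_mem_eq_inf (S.erase x) h (fun y => ((Site.supNorm (x - y) : ℕ) : ℕ∞))
  rw [Finset.mem_erase] at hy
  exact ⟨y, hy.2, hy.1, by rw [hyeq, ENat.toNat_coe]⟩

/-- The nearest-neighbour distance is at most the distance to any other point of the family. [folklore] -/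
theorem nnd_le {S : Finset (Site d)} {x y : Site d} (hy : y ∈ S) (hyx : y ≠ x) :
    ((Finset.erase (S) (x)).inf (fun w => ((Site.supNorm ((x) - w) : ℕ) : ℕ∞))).toNat ≤ Site.supNorm (x - y) := by
  have hmem : y ∈ S.erase x := Finset.mem_erase.2 ⟨hyx, hy⟩
  obtain ⟨y₀, hy₀, h0⟩ := Finset.exists_mem_eq_inf (S.erase x) ⟨y, hmem⟩ (fun y => ((Site.supNorm (x - y) : ℕ) : ℕ∞))
  have hle := Finset.inf_le (f := fun y => ((Site.supNorm (x - y) : ℕ) : ℕ∞)) hmem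
  rw [h0] at hle ⊢
  rw [ENat.toNat_coe]
  exact_mod_cast hle

/-- Distinct lattice sites are at sup-distance `≥ 1`; hence `δ⟦S, x⟧ ≥ 1` as soon as `S` has a point other than `x`. [folklore] -/
theorem one_le_nnd {S : Finset (Site d)} {x : Site d} (h : (S.erase x).Nonempty) : 1 ≤ ((Finset.erase (S) (x)).inf (fun w => ((Site.supNorm ((x) - w) : ℕ) : ℕ∞))).toNat := by
  obtain ⟨y, -, hyx, hδ⟩ := exists_nnd_eq h
  rw [hδ, Nat.one_le_iff_ne_zero, Ne, Site.supNorm_eq_zero_iff, sub_eq_zero]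
  exact fun h' => hyx h'.symm

/-- **The nearest-neighbour radii give pairwise disjoint balls**: for `x ≠ y` in `S`,
`⌊(δ⟦S,x⟧ − 1)/2⌋ + ⌊(δ⟦S,y⟧ − 1)/2⌋ < ‖x − y‖_∞`. [cite: Kesten1986, Thm. (8), (44)] -/
theorem nnd_radii_add_lt {S : Finset (Site d)} {x y : Site d} (hx : x ∈ S) (hy : y ∈ S) (hxy : x ≠ y) :
    (((Finset.erase (S) (x)).inf (fun w => ((Site.supNorm ((x) - w) : ℕ) : ℕ∞))).toNat - 1) / 2 + (((Finset.erase (S) (y)).inf (fun w => ((Site.supNorm ((y) - w) : ℕ) : ℕ∞))).toNat - 1) / 2 < Site.supNorm (x - y) := by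
  have h1 := nnd_le (S := S) hy (Ne.symm hxy)
  have h2 := nnd_le (S := S) hx hxy
  rw [← neg_sub x y, Site.supNorm_neg] at h2
  have h3 : 1 ≤ Site.supNorm (x - y) := by
    rw [Nat.one_le_iff_ne_zero, Ne, Site.supNorm_eq_zero_iff, sub_eq_zero]; exact hxy
  omega

/-- Every nearest-neighbour ball of a family `S ⊆ Λ(n)` containing `0` and another point lies in `Λ(2n)`:
`‖x‖_∞ + ⌊(δ⟦S,x⟧ − 1)/2⌋ + 1 ≤ 2n + 1` for `x ∈ S`. [folklore] -/
theorem supNorm_add_nnd_radius_le {S : Finset (Site d)} {n : ℕ} (hSn : ∀ y ∈ S, Site.supNorm y ≤ n)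
    (h0 : (0 : Site d) ∈ S) (hS : ∃ y ∈ S, y ≠ 0) {x : Site d} (hx : x ∈ S) :
    Site.supNorm x + (((Finset.erase (S) (x)).inf (fun w => ((Site.supNorm ((x) - w) : ℕ) : ℕ∞))).toNat - 1) / 2 + 1 ≤ 2 * n + 1 := by
  have hxn := hSn x hx
  by_cases hx0 : x = 0
  · subst hx0
    obtain ⟨y, hy, hy0⟩ := hS
    have h1 := nnd_le (S := S) hy hy0
    rw [zero_sub, Site.supNorm_neg] at h1
    have := hSn y hy
    omega
  · have h1 := nnd_le (S := S) h0 (fun h => hx0 h.symm)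
    rw [sub_zero] at h1
    omega

/-! ## Inserting a point -/

/-- The nearest-neighbour distance of the inserted point `a ∉ S` is its distance to a nearest point `b ∈ S`. [folklore] -/
theorem nnd_insert_self {S : Finset (Site d)} {a b : Site d} (ha : a ∉ S) (hb : b ∈ S)
    (hnear : ∀ y ∈ S, Site.supNorm (a - b) ≤ Site.supNorm (a - y)) :
    ((Finset.erase (insert a S) (a)).inf (fun w => ((Site.supNorm ((a) - w) : ℕ) : ℕ∞))).toNat = Site.supNorm (a - b) := by
  classical
  have hba : b ≠ a := fun h => ha (h ▸ hb)
  refine le_antisymm (nnd_le (Finset.mem_insert_of_mem hb) hba) ?_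
  have hne : ((insert a S).erase a).Nonempty := ⟨b, Finset.mem_erase.2 ⟨hba, Finset.mem_insert_of_mem hb⟩⟩
  obtain ⟨y, hy, hya, hδ⟩ := exists_nnd_eq hne
  rw [hδ]
  rcases Finset.mem_insert.1 hy with rfl | hyS
  · exact absurd rfl hya
  · exact hnear y hyS

/-- For an old point `x ∈ S` (with another old point), inserting `a ∉ S` changes its nearest-neighbour distance to
`δ⟦S ∪ a, x⟧ = min(‖x − a‖_∞, δ⟦S, x⟧)`. [folklore] -/
theorem nnd_insert_of_mem {S : Finset (Site d)} {a x : Site d} (ha : a ∉ S) (hx : x ∈ S) (hne : (S.erase x).Nonempty) :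
    ((Finset.erase (insert a S) (x)).inf (fun w => ((Site.supNorm ((x) - w) : ℕ) : ℕ∞))).toNat = min (Site.supNorm (x - a)) ((Finset.erase (S) (x)).inf (fun w => ((Site.supNorm ((x) - w) : ℕ) : ℕ∞))).toNat := by
  classical
  have hax : a ≠ x := fun h => ha (h ▸ hx)
  refine le_antisymm (le_min (nnd_le (Finset.mem_insert_self a S) hax) ?_) ?_
  · obtain ⟨y, hy, hyx, hδ⟩ := exists_nnd_eq hne
    rw [hδ]
    exact nnd_le (Finset.mem_insert_of_mem hy) hyx
  · have hne' : ((insert a S).erase x).Nonempty := ⟨a, Finset.mem_erase.2 ⟨hax, Finset.mem_insert_self a S⟩⟩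
    obtain ⟨y, hy, hyx, hδ⟩ := exists_nnd_eq hne'
    rw [hδ]
    rcases Finset.mem_insert.1 hy with rfl | hyS
    · exact min_le_left _ _
    · exact le_trans (min_le_right _ _) (nnd_le hyS hyx)

/-- **Inserting a point at most halves nearest-neighbour distances**: for `a ∉ S` with nearest point `b ∈ S` and an old point `x ∈ S`
(with another old point), `δ⟦S, x⟧ ≤ 2 · δ⟦S ∪ a, x⟧` — if `a` became the nearest neighbour of `x` then
`δ⟦S, x⟧ ≤ ‖x − b‖ ≤ ‖x − a‖ + ‖a − b‖ ≤ 2‖x − a‖` (for `x = b` the second alternative of the `min` is `δ⟦S,b⟧` itself).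
[cite: Kesten1986, Thm. (8), (49)–(50)] -/
theorem nnd_le_two_mul_nnd_insert {S : Finset (Site d)} {a b x : Site d} (ha : a ∉ S) (hb : b ∈ S)
    (hnear : ∀ y ∈ S, Site.supNorm (a - b) ≤ Site.supNorm (a - y)) (hx : x ∈ S) (hxb : x ≠ b)
    (hne : (S.erase x).Nonempty) :
    ((Finset.erase (S) (x)).inf (fun w => ((Site.supNorm ((x) - w) : ℕ) : ℕ∞))).toNat ≤ 2 * ((Finset.erase (insert a S) (x)).inf (fun w => ((Site.supNorm ((x) - w) : ℕ) : ℕ∞))).toNat := by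
  classical
  rw [nnd_insert_of_mem ha hx hne]
  rcases le_total (((Finset.erase (S) (x)).inf (fun w => ((Site.supNorm ((x) - w) : ℕ) : ℕ∞))).toNat) (Site.supNorm (x - a)) with h | h
  · rw [min_eq_right h]; omega
  · rw [min_eq_left h]
    have h1 : ((Finset.erase (S) (x)).inf (fun w => ((Site.supNorm ((x) - w) : ℕ) : ℕ∞))).toNat ≤ Site.supNorm (x - b) := nnd_le hb (fun h' => hxb h'.symm)
    have h2 : Site.supNorm (x - b) ≤ Site.supNorm (x - a) + Site.supNorm (a - b) := by
      have := Site.supNorm_add_le (x - a) (a - b)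
      rwa [sub_add_sub_cancel] at this
    have h3 : Site.supNorm (a - b) ≤ Site.supNorm (a - x) := hnear x hx
    rw [← neg_sub x a, Site.supNorm_neg] at h3
    omega

/-! ## The insertion inequality for nearest-neighbour weights -/

/-- **THE INSERTION INEQUALITY** (Kesten 1986 (49)–(52), in Nguyen's inductive form).  Let `f : ℕ → ℝ` be positive with the
DOUBLING bound `f(u) ≤ D·f(v)` whenever `u ≤ v ≤ 2u`.  Let `S` have at least two points, `a ∉ S`, and let `b ∈ S` be a nearest
point of `S` to `a`.  Then, with `W(S) = ∏_{x ∈ S} f(δ⟦S, x⟧)`,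
`W(S ∪ {a}) ≤ D^{|S|−1} · f(‖a − b‖) · (f(min(‖a − b‖, δ⟦S,b⟧)) / f(δ⟦S,b⟧)) · W(S)`:
the new point contributes `f(‖a−b‖)`, the factor of `b` changes from `f(δ⟦S,b⟧)` to `f(min(‖a−b‖, δ⟦S,b⟧))`, and every other old
factor changes by at most `D` (`nnd_le_two_mul_nnd_insert`). [cite: Kesten1986, Thm. (8), (49)–(52) and footnote 5] -/
theorem prod_insert_nnd_le {f : ℕ → ℝ} {D : ℝ} (hf : ∀ m, 0 < f m)
    (hD : ∀ u v : ℕ, u ≤ v → v ≤ 2 * u → f u ≤ D * f v)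
    {S : Finset (Site d)} {a b : Site d} (ha : a ∉ S) (hb : b ∈ S) (hS : (S.erase b).Nonempty)
    (hnear : ∀ y ∈ S, Site.supNorm (a - b) ≤ Site.supNorm (a - y)) :
    ∏ x ∈ insert a S, f ((Finset.erase (insert a S) (x)).inf (fun w => ((Site.supNorm ((x) - w) : ℕ) : ℕ∞))).toNat ≤
      D ^ (S.card - 1) * (f (Site.supNorm (a - b)) * (f (min (Site.supNorm (a - b)) ((Finset.erase (S) (b)).inf (fun w => ((Site.supNorm ((b) - w) : ℕ) : ℕ∞))).toNat) / f ((Finset.erase (S) (b)).inf (fun w => ((Site.supNorm ((b) - w) : ℕ) : ℕ∞))).toNat)) *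
        ∏ x ∈ S, f ((Finset.erase (S) (x)).inf (fun w => ((Site.supNorm ((x) - w) : ℕ) : ℕ∞))).toNat := by
  classical
  rw [Finset.prod_insert ha, nnd_insert_self ha hb hnear, ← Finset.mul_prod_erase S (fun x => f ((Finset.erase (insert a S) (x)).inf (fun w => ((Site.supNorm ((x) - w) : ℕ) : ℕ∞))).toNat) hb,
    ← Finset.mul_prod_erase S (fun x => f ((Finset.erase (S) (x)).inf (fun w => ((Site.supNorm ((x) - w) : ℕ) : ℕ∞))).toNat) hb, nnd_insert_of_mem ha hb hS, ← neg_sub a b, Site.supNorm_neg]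
  -- the old points other than `b`
  have hle : ∏ x ∈ S.erase b, f ((Finset.erase (insert a S) (x)).inf (fun w => ((Site.supNorm ((x) - w) : ℕ) : ℕ∞))).toNat ≤ ∏ x ∈ S.erase b, (D * f ((Finset.erase (S) (x)).inf (fun w => ((Site.supNorm ((x) - w) : ℕ) : ℕ∞))).toNat) := by
    refine Finset.prod_le_prod (fun x _ => (hf _).le) fun x hx => ?_
    obtain ⟨hxb, hxS⟩ := Finset.mem_erase.1 hx
    have hne : (S.erase x).Nonempty := ⟨b, Finset.mem_erase.2 ⟨Ne.symm hxb, hb⟩⟩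
    refine hD _ _ ?_ (nnd_le_two_mul_nnd_insert ha hb hnear hxS hxb hne)
    rw [nnd_insert_of_mem ha hxS hne]
    exact min_le_right _ _
  rw [Finset.prod_mul_distrib, Finset.prod_const, Finset.card_erase_of_mem hb] at hle
  set P1 := ∏ x ∈ S.erase b, f ((Finset.erase (insert a S) (x)).inf (fun w => ((Site.supNorm ((x) - w) : ℕ) : ℕ∞))).toNat with hP1
  set P0 := ∏ x ∈ S.erase b, f ((Finset.erase (S) (x)).inf (fun w => ((Site.supNorm ((x) - w) : ℕ) : ℕ∞))).toNat with hP0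
  have hfab := (hf (Site.supNorm (a - b))).le
  have hfm := (hf (min (Site.supNorm (a - b)) ((Finset.erase (S) (b)).inf (fun w => ((Site.supNorm ((b) - w) : ℕ) : ℕ∞))).toNat)).le
  have hfb := hf ((Finset.erase (S) (b)).inf (fun w => ((Site.supNorm ((b) - w) : ℕ) : ℕ∞))).toNat
  calc f (Site.supNorm (a - b)) * (f (min (Site.supNorm (a - b)) ((Finset.erase (S) (b)).inf (fun w => ((Site.supNorm ((b) - w) : ℕ) : ℕ∞))).toNat) * P1)
      ≤ f (Site.supNorm (a - b)) * (f (min (Site.supNorm (a - b)) ((Finset.erase (S) (b)).inf (fun w => ((Site.supNorm ((b) - w) : ℕ) : ℕ∞))).toNat) * (D ^ (S.card - 1) * P0)) :=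
        mul_le_mul_of_nonneg_left (mul_le_mul_of_nonneg_left hle hfm) hfab
    _ = D ^ (S.card - 1) * (f (Site.supNorm (a - b)) * (f (min (Site.supNorm (a - b)) ((Finset.erase (S) (b)).inf (fun w => ((Site.supNorm ((b) - w) : ℕ) : ℕ∞))).toNat) / f ((Finset.erase (S) (b)).inf (fun w => ((Site.supNorm ((b) - w) : ℕ) : ℕ∞))).toNat)) *
          (f ((Finset.erase (S) (b)).inf (fun w => ((Site.supNorm ((b) - w) : ℕ) : ℕ∞))).toNat * P0) := by
        field_simp

/-- A family with at least two points has another point besides any given one. [folklore] -/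
theorem erase_nonempty_of_one_lt_card {S : Finset (Site d)} (hS : 1 < S.card) (b : Site d) : (S.erase b).Nonempty := by
  classical
  rw [← Finset.card_pos]
  have := Finset.card_erase_le (s := S) (a := b)
  by_cases hb : b ∈ S
  · rw [Finset.card_erase_of_mem hb]; omega
  · rw [Finset.erase_eq_of_notMem hb]; omega

/-- **The insertion inequality, summed over the nearest point**: for `a ∉ S`, `|S| ≥ 2`,
`W(S ∪ {a}) ≤ D^{|S|−1} · W(S) · Σ_{b ∈ S} f(‖a−b‖)·f(min(‖a−b‖, δ⟦S,b⟧))/f(δ⟦S,b⟧)` (a nearest point exists; the other terms are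
nonnegative). [cite: Kesten1986, Thm. (8), (51)–(52)] -/
theorem prod_insert_nnd_le_sum {f : ℕ → ℝ} {D : ℝ} (hf : ∀ m, 0 < f m)
    (hD : ∀ u v : ℕ, u ≤ v → v ≤ 2 * u → f u ≤ D * f v)
    {S : Finset (Site d)} (hS : 1 < S.card) {a : Site d} (ha : a ∉ S) :
    ∏ x ∈ insert a S, f ((Finset.erase (insert a S) (x)).inf (fun w => ((Site.supNorm ((x) - w) : ℕ) : ℕ∞))).toNat ≤
      D ^ (S.card - 1) * (∏ x ∈ S, f ((Finset.erase (S) (x)).inf (fun w => ((Site.supNorm ((x) - w) : ℕ) : ℕ∞))).toNat) *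
        ∑ b ∈ S, f (Site.supNorm (a - b)) * (f (min (Site.supNorm (a - b)) ((Finset.erase (S) (b)).inf (fun w => ((Site.supNorm ((b) - w) : ℕ) : ℕ∞))).toNat) / f ((Finset.erase (S) (b)).inf (fun w => ((Site.supNorm ((b) - w) : ℕ) : ℕ∞))).toNat) := by
  classical
  have hSne : S.Nonempty := Finset.card_pos.1 (by omega)
  obtain ⟨b, hb, hnear⟩ := Finset.exists_min_image S (fun y => Site.supNorm (a - y)) hSne
  have h := prod_insert_nnd_le hf hD ha hb (erase_nonempty_of_one_lt_card hS b) hnear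
  have hW : 0 ≤ ∏ x ∈ S, f ((Finset.erase (S) (x)).inf (fun w => ((Site.supNorm ((x) - w) : ℕ) : ℕ∞))).toNat := Finset.prod_nonneg fun x _ => (hf _).le
  have hD1 : 0 ≤ D := by
    have h1 := hD 1 1 le_rfl (by norm_num)
    have := hf 1
    nlinarith
  have hsingle : f (Site.supNorm (a - b)) * (f (min (Site.supNorm (a - b)) ((Finset.erase (S) (b)).inf (fun w => ((Site.supNorm ((b) - w) : ℕ) : ℕ∞))).toNat) / f ((Finset.erase (S) (b)).inf (fun w => ((Site.supNorm ((b) - w) : ℕ) : ℕ∞))).toNat) ≤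
      ∑ b ∈ S, f (Site.supNorm (a - b)) * (f (min (Site.supNorm (a - b)) ((Finset.erase (S) (b)).inf (fun w => ((Site.supNorm ((b) - w) : ℕ) : ℕ∞))).toNat) / f ((Finset.erase (S) (b)).inf (fun w => ((Site.supNorm ((b) - w) : ℕ) : ℕ∞))).toNat) :=
    Finset.single_le_sum (f := fun b => f (Site.supNorm (a - b)) * (f (min (Site.supNorm (a - b)) ((Finset.erase (S) (b)).inf (fun w => ((Site.supNorm ((b) - w) : ℕ) : ℕ∞))).toNat) / f ((Finset.erase (S) (b)).inf (fun w => ((Site.supNorm ((b) - w) : ℕ) : ℕ∞))).toNat))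
      (fun b _ => mul_nonneg (hf _).le (div_nonneg (hf _).le (hf _).le)) hb
  calc ∏ x ∈ insert a S, f ((Finset.erase (insert a S) (x)).inf (fun w => ((Site.supNorm ((x) - w) : ℕ) : ℕ∞))).toNat
      ≤ D ^ (S.card - 1) * (f (Site.supNorm (a - b)) * (f (min (Site.supNorm (a - b)) ((Finset.erase (S) (b)).inf (fun w => ((Site.supNorm ((b) - w) : ℕ) : ℕ∞))).toNat) / f ((Finset.erase (S) (b)).inf (fun w => ((Site.supNorm ((b) - w) : ℕ) : ℕ∞))).toNat)) *
          ∏ x ∈ S, f ((Finset.erase (S) (x)).inf (fun w => ((Site.supNorm ((x) - w) : ℕ) : ℕ∞))).toNat := h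
    _ = D ^ (S.card - 1) * (∏ x ∈ S, f ((Finset.erase (S) (x)).inf (fun w => ((Site.supNorm ((x) - w) : ℕ) : ℕ∞))).toNat) *
          (f (Site.supNorm (a - b)) * (f (min (Site.supNorm (a - b)) ((Finset.erase (S) (b)).inf (fun w => ((Site.supNorm ((b) - w) : ℕ) : ℕ∞))).toNat) / f ((Finset.erase (S) (b)).inf (fun w => ((Site.supNorm ((b) - w) : ℕ) : ℕ∞))).toNat)) := by ring
    _ ≤ D ^ (S.card - 1) * (∏ x ∈ S, f ((Finset.erase (S) (x)).inf (fun w => ((Site.supNorm ((x) - w) : ℕ) : ℕ∞))).toNat) *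
          ∑ b ∈ S, f (Site.supNorm (a - b)) * (f (min (Site.supNorm (a - b)) ((Finset.erase (S) (b)).inf (fun w => ((Site.supNorm ((b) - w) : ℕ) : ℕ∞))).toNat) / f ((Finset.erase (S) (b)).inf (fun w => ((Site.supNorm ((b) - w) : ℕ) : ℕ∞))).toNat) :=
        mul_le_mul_of_nonneg_left hsingle (mul_nonneg (pow_nonneg hD1 _) hW)

/-- **The insertion inequality, summed over the inserted point** (`|S| ≥ 2`, any finite `T`):
`Σ_{a ∈ T} W(S ∪ {a}) ≤ W(S) · (|S| + D^{|S|−1} · Σ_{b ∈ S} Σ_{a ∈ T} f(‖a−b‖)·f(min(‖a−b‖, δ⟦S,b⟧))/f(δ⟦S,b⟧))`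
(for `a ∈ S` the family is unchanged: at most `|S|` such terms). [cite: Kesten1986, Thm. (8), (51)–(53)] -/
theorem sum_prod_insert_nnd_le {f : ℕ → ℝ} {D : ℝ} (hf : ∀ m, 0 < f m)
    (hD : ∀ u v : ℕ, u ≤ v → v ≤ 2 * u → f u ≤ D * f v)
    {S : Finset (Site d)} (hS : 1 < S.card) (T : Finset (Site d)) :
    ∑ a ∈ T, ∏ x ∈ insert a S, f ((Finset.erase (insert a S) (x)).inf (fun w => ((Site.supNorm ((x) - w) : ℕ) : ℕ∞))).toNat ≤
      (∏ x ∈ S, f ((Finset.erase (S) (x)).inf (fun w => ((Site.supNorm ((x) - w) : ℕ) : ℕ∞))).toNat) * (S.card + D ^ (S.card - 1) *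
        ∑ b ∈ S, ∑ a ∈ T, f (Site.supNorm (a - b)) * (f (min (Site.supNorm (a - b)) ((Finset.erase (S) (b)).inf (fun w => ((Site.supNorm ((b) - w) : ℕ) : ℕ∞))).toNat) / f ((Finset.erase (S) (b)).inf (fun w => ((Site.supNorm ((b) - w) : ℕ) : ℕ∞))).toNat)) := by
  classical
  set W : ℝ := ∏ x ∈ S, f ((Finset.erase (S) (x)).inf (fun w => ((Site.supNorm ((x) - w) : ℕ) : ℕ∞))).toNat with hWdef
  set F : Site d → Site d → ℝ := fun a b =>
    f (Site.supNorm (a - b)) * (f (min (Site.supNorm (a - b)) ((Finset.erase (S) (b)).inf (fun w => ((Site.supNorm ((b) - w) : ℕ) : ℕ∞))).toNat) / f ((Finset.erase (S) (b)).inf (fun w => ((Site.supNorm ((b) - w) : ℕ) : ℕ∞))).toNat) with hF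
  have hW : 0 ≤ W := Finset.prod_nonneg fun x _ => (hf _).le
  have hF0 : ∀ a b, 0 ≤ F a b := fun a b => mul_nonneg (hf _).le (div_nonneg (hf _).le (hf _).le)
  have hD1 : 0 ≤ D := by
    have h1 := hD 1 1 le_rfl (by norm_num)
    have := hf 1
    nlinarith
  rw [← Finset.sum_filter_add_sum_filter_not T (fun a => a ∈ S)]
  -- old points: the family does not change
  have hA : ∑ a ∈ T.filter (fun a => a ∈ S), ∏ x ∈ insert a S, f ((Finset.erase (insert a S) (x)).inf (fun w => ((Site.supNorm ((x) - w) : ℕ) : ℕ∞))).toNat ≤ W * S.card := by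
    have heq : ∀ a ∈ T.filter (fun a => a ∈ S), ∏ x ∈ insert a S, f ((Finset.erase (insert a S) (x)).inf (fun w => ((Site.supNorm ((x) - w) : ℕ) : ℕ∞))).toNat = W := by
      intro a ha
      rw [Finset.insert_eq_of_mem (Finset.mem_filter.1 ha).2]
    rw [Finset.sum_congr rfl heq, Finset.sum_const, nsmul_eq_mul, mul_comm]
    refine mul_le_mul_of_nonneg_left ?_ hW
    exact_mod_cast Finset.card_le_card (fun a ha => (Finset.mem_filter.1 ha).2)
  -- new points: the insertion inequality
  have hB : ∑ a ∈ T.filter (fun a => a ∉ S), ∏ x ∈ insert a S, f ((Finset.erase (insert a S) (x)).inf (fun w => ((Site.supNorm ((x) - w) : ℕ) : ℕ∞))).toNat ≤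
      W * (D ^ (S.card - 1) * ∑ b ∈ S, ∑ a ∈ T, F a b) := by
    calc ∑ a ∈ T.filter (fun a => a ∉ S), ∏ x ∈ insert a S, f ((Finset.erase (insert a S) (x)).inf (fun w => ((Site.supNorm ((x) - w) : ℕ) : ℕ∞))).toNat
        ≤ ∑ a ∈ T.filter (fun a => a ∉ S), D ^ (S.card - 1) * W * ∑ b ∈ S, F a b :=
          Finset.sum_le_sum fun a ha => prod_insert_nnd_le_sum hf hD hS (Finset.mem_filter.1 ha).2
      _ ≤ ∑ a ∈ T, D ^ (S.card - 1) * W * ∑ b ∈ S, F a b :=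
          Finset.sum_le_sum_of_subset_of_nonneg (Finset.filter_subset _ _) fun a _ _ =>
            mul_nonneg (mul_nonneg (pow_nonneg hD1 _) hW) (Finset.sum_nonneg fun b _ => hF0 a b)
      _ = W * (D ^ (S.card - 1) * ∑ b ∈ S, ∑ a ∈ T, F a b) := by
          rw [← Finset.mul_sum, Finset.sum_comm]; ring
  calc _ ≤ W * S.card + W * (D ^ (S.card - 1) * ∑ b ∈ S, ∑ a ∈ T, F a b) := add_le_add hA hB
    _ = W * (S.card + D ^ (S.card - 1) * ∑ b ∈ S, ∑ a ∈ T, F a b) := by ring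

/-! ## Pairs, singletons, boxes -/

/-- The two nearest-neighbour distances of a pair `{a, b}`, `a ≠ b`, are both `‖a − b‖`. [folklore] -/
theorem nnd_pair_left {a b : Site d} (hab : a ≠ b) : ((Finset.erase (insert a {b}) (a)).inf (fun w => ((Site.supNorm ((a) - w) : ℕ) : ℕ∞))).toNat = Site.supNorm (a - b) := by
  classical
  have ha : a ∉ ({b} : Finset (Site d)) := fun h => hab (Finset.mem_singleton.1 h)
  rw [Finset.erase_insert ha, Finset.inf_singleton, ENat.toNat_coe]

/-- The two nearest-neighbour distances of a pair `{a, b}`, `a ≠ b`, are both `‖a − b‖`. [folklore] -/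
theorem nnd_pair_right {a b : Site d} (hab : a ≠ b) : ((Finset.erase (insert a {b}) (b)).inf (fun w => ((Site.supNorm ((b) - w) : ℕ) : ℕ∞))).toNat = Site.supNorm (a - b) := by
  classical
  rw [Finset.erase_insert_of_ne hab, Finset.erase_singleton, insert_empty_eq, Finset.inf_singleton, ENat.toNat_coe,
    ← neg_sub a b, Site.supNorm_neg]

/-- The nearest-neighbour distance in a singleton is `0` by convention, so `W({0}) = π(0) = 1`. [folklore] -/
theorem nnd_singleton (a : Site d) : ((Finset.erase (({a} : Finset (Site d))) (a)).inf (fun w => ((Site.supNorm ((a) - w) : ℕ) : ℕ∞))).toNat = 0 := by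
  rw [Finset.erase_singleton, Finset.inf_empty, ENat.toNat_top]

/-- Two points of `Λ(n)`: the nearest-neighbour distance of a point of a family `S ⊆ Λ(n)` with another point is `≤ 2n`. [folklore] -/
theorem nnd_le_two_mul_of_subset_box {n : ℕ} {S : Finset (Site d)} (hSn : S ⊆ box d n) {b : Site d} (hb : b ∈ S)
    (hne : (S.erase b).Nonempty) : ((Finset.erase (S) (b)).inf (fun w => ((Site.supNorm ((b) - w) : ℕ) : ℕ∞))).toNat ≤ 2 * n := by
  obtain ⟨y, hy, hyb, hδ⟩ := exists_nnd_eq hne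
  rw [hδ, ← mem_box_iff_supNorm_le]
  exact sub_mem_box_two_mul (hSn hb) (hSn hy)

/-! ## Tuples `q : Fin t → Λ(n)` and the families `S(q) = {0} ∪ range q` -/

/-- `range (cons a q) = {a} ∪ range q`. [folklore] -/
theorem image_univ_cons {t : ℕ} (a : Site d) (q : Fin t → Site d) :
    Finset.univ.image (Fin.cons a q : Fin (t + 1) → Site d) = insert a (Finset.univ.image q) := by
  classical
  ext z
  simp only [Finset.mem_image, Finset.mem_univ, true_and, Finset.mem_insert, Fin.exists_fin_succ, Fin.cons_zero,
    Fin.cons_succ]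
  constructor
  · rintro (h | ⟨i, h⟩)
    · exact Or.inl h.symm
    · exact Or.inr ⟨i, h⟩
  · rintro (h | ⟨i, h⟩)
    · exact Or.inl h.symm
    · exact Or.inr ⟨i, h⟩

/-- **Splitting off the first coordinate**: `Σ_{q : Fin (t+1) → Λ} g(q) = Σ_{a ∈ Λ} Σ_{q : Fin t → Λ} g(cons a q)`. [folklore] -/
theorem sum_piFinset_succ_const {β : Type*} [AddCommMonoid β] (s : Finset (Site d)) (t : ℕ)
    (g : (Fin (t + 1) → Site d) → β) :
    ∑ q ∈ Fintype.piFinset (fun _ : Fin (t + 1) => s), g q =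
      ∑ a ∈ s, ∑ q ∈ Fintype.piFinset (fun _ : Fin t => s), g (Fin.cons a q) := by
  classical
  rw [← Finset.sum_product']
  symm
  refine Finset.sum_equiv (Fin.consEquiv fun _ : Fin (t + 1) => Site d) (fun x => ?_) (fun x _ => rfl)
  rw [Finset.mem_product, Fintype.mem_piFinset, Fintype.mem_piFinset, Fin.forall_fin_succ]
  simp only [Fin.consEquiv, Equiv.coe_fn_mk, Fin.cons_zero, Fin.cons_succ]

/-- The empty tuple: `Σ_{q : Fin 0 → Λ} g(q) = g(elim)` — the sum has exactly one term, and `range q = ∅`. [folklore] -/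
theorem sum_piFinset_zero_const {β : Type*} [AddCommMonoid β] (s : Finset (Site d)) (c : β)
    (g : (Fin 0 → Site d) → β) (hg : ∀ q, g q = c) :
    ∑ q ∈ Fintype.piFinset (fun _ : Fin 0 => s), g q = c := by
  classical
  rw [Finset.sum_congr rfl fun q _ => hg q, Finset.sum_const, Fintype.card_piFinset, Finset.univ_eq_empty,
    Finset.prod_empty, one_smul]

/-- `|S(q)| ≤ t + 1` for `q : Fin t → Λ`. [folklore] -/
theorem card_insert_image_le {t : ℕ} (q : Fin t → Site d) :
    (insert (0 : Site d) (Finset.univ.image q)).card ≤ t + 1 := by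
  classical
  refine (Finset.card_insert_le _ _).trans ?_
  have := Finset.card_image_le (s := (Finset.univ : Finset (Fin t))) (f := q)
  rw [Finset.card_univ, Fintype.card_fin] at this
  omega

/-- `S(q) ⊆ Λ(n)` for `q : Fin t → Λ(n)`. [folklore] -/
theorem insert_image_subset_box {t n : ℕ} {q : Fin t → Site d}
    (hq : q ∈ Fintype.piFinset (fun _ : Fin t => box d n)) :
    insert (0 : Site d) (Finset.univ.image q) ⊆ box d n := by
  classical
  rw [Fintype.mem_piFinset] at hq
  intro z hz
  rcases Finset.mem_insert.1 hz with rfl | hz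
  · exact zero_mem_box d n
  · obtain ⟨i, -, rfl⟩ := Finset.mem_image.1 hz
    exact hq i


/-- `⋂_i {0 ↔ q_i} = ⋂_{x ∈ S(q)} {0 ↔ x}` (the extra point `0` contributes the sure event `{0 ↔ 0}`). [folklore] -/
theorem iInter_openConn_eq_biInter {t : ℕ} (q : Fin t → Site d) :
    (⋂ i, (openConn (0 : Site d) (q i) : Set (BondConfig (Site d)))) =
      ⋂ x ∈ insert (0 : Site d) (Finset.univ.image q), (openConn (0 : Site d) x : Set (BondConfig (Site d))) := by
  classical
  ext ω
  simp only [Set.mem_iInter, Finset.mem_insert, Finset.mem_image, Finset.mem_univ, true_and]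
  constructor
  · intro h x hx
    rcases hx with rfl | ⟨i, rfl⟩
    · exact SimpleGraph.Reachable.refl _
    · exact h i
  · intro h i
    exact h (q i) (Or.inr ⟨i, rfl⟩)

end Rsw3

end Summit.CriticalPhenomena.PercolationContinuityZ3.Theorems
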